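import Summits.BirchSwinnertonDyer.BirchSwinnertonDyer.Theorems.ResidualThetaTransportAtTwoThetaLayerLambdaCongruenceAtTwoDepletionInjective
import Literature.NumberTheory.EllipticCurves.DeligneHeckeEigenvalueBoundProofs
import HarnessLib

/-!
# Crux `ThetaLayerLambdaCongruenceAtTwo` (stmt-BirchSwinnertonDyer-20688, route ResidualThetaTransportAtTwo), line
# `birth`: the Euler-factor non-degeneracy (NR-g) FROM the tree's Deligne named fact at the good primes, and the crux
# from (C3) + (μ-W₁) + Deligne + the Atkin–Lehner bound at the level primes (width seat bsd-wall-rtt-p3-w3 g2;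
# `--supports stmt-BirchSwinnertonDyer-20688 --as helper`; closes nothing)

HONEST FRAMING. THEOREMS ONLY; the inputs are the tree's NAMED FACT `Deligne1974_heckeT_eigenvalue_norm_le` (Deligne,
Weil I, Thm. 8.2 in the Murty–Sinha form; unproved in the tree, taken as a hypothesis) and an explicit hypothesis
(AL) at the primes of the level; nothing about any curve or form is asserted; BSD is not proved by any of this.

WHAT. (NR-g) of `…DepletionInjective` asks that `P_{g,ℓ}(ζ/ℓ) ≠ 0` for every root of unity `ζ ∈ ℚ̄₂`,
`P_{g,ℓ}(X) = 1 − ι a_ℓ(g) X + 𝟙_{ℓ∤M} ℓ X²`. §1 (transfer `ℚ̄₂ → ℂ`): a root of unity `ζ ∈ ℚ̄₂` that is a root of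
`Q^ι` for `Q ∈ K_g[X]` makes `Q` and `X^m − 1` non-coprime in `K_g[X]`, hence gives a COMPLEX root of unity `z` with
`Q(z) = 0` (`Polynomial.isCoprime_iff_aeval_ne_zero_of_isAlgClosed`, used over `ℚ̄₂` and over `ℂ`). §2 good primes
`ℓ ∤ M`: `z² − a_ℓ(g) z + ℓ = 0` with `|z| = 1` contradicts `|z| = √ℓ` (`Deligne1974_heckeT_eigenvalue_norm_le.norm_root_eq`,
`T_ℓ g = a_ℓ g`). §3 level primes `ℓ ∣ M`: `a_ℓ(g) z = ℓ` with `|z| = 1` contradicts (AL) `|a_ℓ(g)| ≤ 1` (Atkin–Lehner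
1970 Thm. 3 / Li 1975 Thm. 3: `a_ℓ ∈ {0, ±1}` for weight-`2` newforms with trivial character; hypothesis). §4 the crux
BY NAME from (C3) + (μ-W₁) + Deligne + (AL) (`thetaLayerLambdaCongruenceAtTwo_of_plusLine_curveMax_deligne`).

References: [Deligne1974] Thm. 8.2; [AtkinLehner1970] Thm. 3; [Li1975] Thm. 3; [MurtySinha2009] §1.
-/

noncomputable section

-- justification: the `Summit.BirchSwinnertonDyer.BirchSwinnertonDyer.…` path repeats a component (route-file convention)
set_option linter.dupNamespace false

open scoped Classical MatrixGroups

open Polynomial CongruenceSubgroup Literature.NumberTheory.EllipticCurves Literature.NumberTheory.EllipticCurves.ModularForms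

namespace Summit.BirchSwinnertonDyer.BirchSwinnertonDyer.Theorems.ThetaLayerLambdaCongruenceAtTwo

/-! ## §1. Transfer: a `ℚ̄₂`-root of unity that is a root of `Q^ι` gives a complex root of unity that is a root of `Q` -/

section Transfer

variable {M : ℕ} {g : CuspForm (CongruenceSubgroup.Gamma0 M) 2} (ι : coeffField g →+* PadicAlgCl 2)

/-- If `Q ∈ K_g[X]` has a root `ζ ∈ ℚ̄₂` (along `ι`) with `ζ^m = 1`, `m > 0`, then `Q` has a root `z ∈ ℂ` (along
`K_g ⊂ ℂ`) with `z^m = 1`: `Q` and `X^m − 1` are not coprime in `K_g[X]`. [folklore] -/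
theorem exists_complex_rootOfUnity_root_of_padic (Q : (coeffField g)[X]) {ζ : PadicAlgCl 2} {m : ℕ}
    (hζm : ζ ^ m = 1) (hQ : (Q.map ι).eval ζ = 0) :
    ∃ z : ℂ, z ^ m = 1 ∧ aeval z Q = 0 := by
  have hnc : ¬ IsCoprime Q (X ^ m - 1 : (coeffField g)[X]) := by
    intro hcop
    letI : Algebra (coeffField g) (PadicAlgCl 2) := ι.toAlgebra
    rcases (Polynomial.isCoprime_iff_aeval_ne_zero_of_isAlgClosed (coeffField g) (PadicAlgCl 2) Q
      (X ^ m - 1)).mp hcop ζ with h | h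
    · apply h
      rw [aeval_def, eval₂_eq_eval_map]
      exact hQ
    · apply h
      rw [map_sub, map_pow, aeval_X, map_one, hζm, sub_self]
  by_contra hne
  push Not at hne
  refine hnc ((Polynomial.isCoprime_iff_aeval_ne_zero_of_isAlgClosed (coeffField g) ℂ Q (X ^ m - 1)).mpr
    fun z ↦ ?_)
  by_cases hz : aeval z Q = 0
  · refine Or.inr ?_
    rw [map_sub, map_pow, aeval_X, map_one]
    exact sub_ne_zero.mpr (hne z · hz)
  · exact Or.inl hz

/-- A complex root of unity has absolute value `1`. [folklore] -/
theorem norm_eq_one_of_pow_eq_one_complex {z : ℂ} {m : ℕ} (hm : 0 < m) (hz : z ^ m = 1) : ‖z‖ = 1 := by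
  have h : ‖z‖ ^ m = 1 := by rw [← norm_pow, hz, norm_one]
  exact (pow_eq_one_iff_of_nonneg (norm_nonneg z) hm.ne').mp h

end Transfer

/-! ## §2. Good primes: (NR) from Deligne's bound -/

section Good

variable {M : ℕ} [NeZero M] {g : CuspForm (CongruenceSubgroup.Gamma0 M) 2} (ι : coeffField g →+* PadicAlgCl 2)

/-- **(NR-g) at a good prime `ℓ ∤ M` from Deligne's bound.** For a newform `g` on `Γ₀(M)` and a root of unity
`ζ ∈ ℚ̄₂`: `P_{g,ℓ}(ζ/ℓ) = 1 − ι a_ℓ(g) ζ/ℓ + ζ²/ℓ ≠ 0`. Otherwise `X² − a_ℓ X + ℓ ∈ K_g[X]` has the root `ζ` along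
`ι`, hence (§1) a complex root of unity `z`, `|z| = 1`; but `a_ℓ(g)` is an eigenvalue of `T_ℓ` on `S₂(Γ₀(M))`
(`IsNewform0.heckeT_eq_coeff_smul`) so Deligne's fact gives `|z| = √ℓ > 1`.
[cite: Deligne1974, Thm. (8.2) (p. 302) (the input, as the tree's named fact)] -/
theorem eval_partnerEulerPolynomial_ne_zero_of_deligne (hD : Deligne1974_heckeT_eigenvalue_norm_le)
    (hg : IsNewform0 g) {ℓ : ℕ} (hℓ : ℓ.Prime) (hℓM : ¬ ℓ ∣ M) (ζ : PadicAlgCl 2)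
    (hζ : ∃ m : ℕ, 0 < m ∧ ζ ^ m = 1) :
    Polynomial.eval (ζ * ((ℓ : PadicAlgCl 2))⁻¹) (1 - Polynomial.C (embCoeff g ι ℓ) * Polynomial.X +
      (if ℓ ∣ M then 0 else Polynomial.C (ℓ : PadicAlgCl 2)) * Polynomial.X ^ 2 : Polynomial (PadicAlgCl 2)) ≠ 0 := by
  obtain ⟨m, hm, hζm⟩ := hζ
  haveI : NeZero ℓ := ⟨hℓ.ne_zero⟩
  rw [if_neg hℓM]
  intro heval
  have hℓ0 : (ℓ : PadicAlgCl 2) ≠ 0 := by exact_mod_cast hℓ.ne_zero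
  -- `ζ` is a root of `X² − a_ℓ X + ℓ` along `ι`
  have hQ : ((X ^ 2 - C (⟨cuspCoeff g ℓ, coeff_mem_coeffField g ℓ⟩ : coeffField g) * X + C (ℓ : coeffField g) :
      (coeffField g)[X]).map ι).eval ζ = 0 := by
    have e : ((X ^ 2 - C (⟨cuspCoeff g ℓ, coeff_mem_coeffField g ℓ⟩ : coeffField g) * X + C (ℓ : coeffField g) :
        (coeffField g)[X]).map ι).eval ζ =
        (ℓ : PadicAlgCl 2) * Polynomial.eval (ζ * ((ℓ : PadicAlgCl 2))⁻¹)
          (1 - Polynomial.C (embCoeff g ι ℓ) * Polynomial.X + Polynomial.C (ℓ : PadicAlgCl 2) * Polynomial.X ^ 2) := by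
      rw [embCoeff_def]
      simp only [Polynomial.map_add, Polynomial.map_sub, Polynomial.map_pow, Polynomial.map_mul, map_X, map_C,
        map_natCast, Polynomial.map_natCast, eval_add, eval_sub, eval_pow, eval_mul, eval_X, eval_C, eval_natCast,
        eval_one]
      field_simp
      ring
    rw [e, heval, mul_zero]
  obtain ⟨z, hzm, hz⟩ := exists_complex_rootOfUnity_root_of_padic ι _ hζm hQ
  have hz1 : ‖z‖ = 1 := norm_eq_one_of_pow_eq_one_complex hm hzm
  -- `z² − a_ℓ(g) z + ℓ = 0` in `ℂ`
  have hroot : z ^ 2 - cuspCoeff g ℓ * z + (ℓ : ℂ) ^ ((2 : ℤ) - 1) = 0 := by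
    have h2 : ((2 : ℤ) - 1) = 1 := by norm_num
    rw [h2, zpow_one]
    have hz' := hz
    simp only [map_add, map_sub, map_mul, map_pow, aeval_X, aeval_C, map_natCast] at hz'
    rw [← hz']
    rfl
  -- `a_ℓ(g)` is an eigenvalue of `T_ℓ` on `S₂(Γ₀(M))`
  have hμ : Module.End.HasEigenvalue (heckeT (Gamma0 M) 2 ℓ) (cuspCoeff g ℓ) :=
    Module.End.hasEigenvalue_of_hasEigenvector
      ⟨Module.End.mem_eigenspace_iff.mpr (hg.heckeT_eq_coeff_smul hℓ), IsNormalized.ne_zero_gamma0 hg.2.2⟩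
  have hnorm := hD.norm_root_eq (k := 2) le_rfl hℓ hℓM hμ hroot
  rw [hz1] at hnorm
  have hlt : (1 : ℝ) < (ℓ : ℝ) ^ ((((2 : ℤ) : ℝ) - 1) / 2) :=
    Real.one_lt_rpow (by exact_mod_cast hℓ.one_lt) (by norm_num)
  exact (ne_of_lt hlt) hnorm

end Good

/-! ## §3. Level primes: (NR) from the Atkin–Lehner bound `|a_ℓ(g)| ≤ 1` -/

section Level

variable {M : ℕ} [NeZero M] {g : CuspForm (CongruenceSubgroup.Gamma0 M) 2} (ι : coeffField g →+* PadicAlgCl 2)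

omit [NeZero M] in
/-- **(NR-g) at a level prime `ℓ ∣ M` from `|a_ℓ(g)| ≤ 1`.** For a root of unity `ζ ∈ ℚ̄₂`:
`P_{g,ℓ}(ζ/ℓ) = 1 − ι a_ℓ(g) ζ/ℓ ≠ 0`; otherwise `C a_ℓ · X − C ℓ ∈ K_g[X]` has the root `ζ` along `ι`, hence (§1) a
complex root of unity `z` with `a_ℓ(g) z = ℓ`, so `|a_ℓ(g)| = ℓ > 1`. The bound `|a_ℓ(g)| ≤ 1` at `ℓ ∣ M` is
Atkin–Lehner's `a_ℓ ∈ {0, ±1}` for weight-`2` newforms with trivial character (a hypothesis here).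
[cite: AtkinLehner1970, Thm. 3 (the input, as a hypothesis)] -/
theorem eval_partnerEulerPolynomial_ne_zero_of_levelCoeffBound {ℓ : ℕ} (hℓ : ℓ.Prime) (hℓM : ℓ ∣ M)
    (hAL : ‖cuspCoeff g ℓ‖ ≤ 1) (ζ : PadicAlgCl 2) (hζ : ∃ m : ℕ, 0 < m ∧ ζ ^ m = 1) :
    Polynomial.eval (ζ * ((ℓ : PadicAlgCl 2))⁻¹) (1 - Polynomial.C (embCoeff g ι ℓ) * Polynomial.X +
      (if ℓ ∣ M then 0 else Polynomial.C (ℓ : PadicAlgCl 2)) * Polynomial.X ^ 2 : Polynomial (PadicAlgCl 2)) ≠ 0 := by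
  obtain ⟨m, hm, hζm⟩ := hζ
  rw [if_pos hℓM]
  intro heval
  have hℓ0 : (ℓ : PadicAlgCl 2) ≠ 0 := by exact_mod_cast hℓ.ne_zero
  -- `ζ` is a root of `a_ℓ X − ℓ` along `ι`
  have hQ : ((C (⟨cuspCoeff g ℓ, coeff_mem_coeffField g ℓ⟩ : coeffField g) * X - C (ℓ : coeffField g) :
      (coeffField g)[X]).map ι).eval ζ = 0 := by
    have e : ((C (⟨cuspCoeff g ℓ, coeff_mem_coeffField g ℓ⟩ : coeffField g) * X - C (ℓ : coeffField g) :
        (coeffField g)[X]).map ι).eval ζ =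
        -(ℓ : PadicAlgCl 2) * Polynomial.eval (ζ * ((ℓ : PadicAlgCl 2))⁻¹)
          (1 - Polynomial.C (embCoeff g ι ℓ) * Polynomial.X + 0 * Polynomial.X ^ 2) := by
      rw [embCoeff_def]
      simp only [Polynomial.map_sub, Polynomial.map_mul, map_X, map_C, map_natCast, Polynomial.map_natCast,
        eval_sub, eval_mul, eval_X, eval_C, eval_natCast, eval_one, zero_mul, add_zero]
      field_simp
      ring
    rw [e, heval, mul_zero]
  obtain ⟨z, hzm, hz⟩ := exists_complex_rootOfUnity_root_of_padic ι _ hζm hQ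
  have hz1 : ‖z‖ = 1 := norm_eq_one_of_pow_eq_one_complex hm hzm
  -- `a_ℓ(g) z = ℓ` in `ℂ`, so `|a_ℓ(g)| = ℓ > 1`
  simp only [map_sub, map_mul, aeval_C, aeval_X, map_natCast] at hz
  have hnorm : ‖cuspCoeff g ℓ‖ = ℓ := by
    have h := congrArg (fun w : ℂ ↦ ‖w‖) (sub_eq_zero.mp hz)
    simp only [norm_mul, hz1, mul_one, Complex.norm_natCast] at h
    exact h
  have h1 : (1 : ℝ) < ℓ := by exact_mod_cast hℓ.one_lt
  linarith

end Level


/-! ## §4. THE CRUX BY NAME from (C3) + (μ-W₁) + Deligne's named fact + the Atkin–Lehner level bound -/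

section Glue

/-- **THE CRUX `ThetaLayerLambdaCongruenceAtTwo` BY NAME from (C3) + (μ-W₁) + DELIGNE + (AL).** The partner-side
input of line `birth` is now: the tree's NAMED FACT `Deligne1974_heckeT_eigenvalue_norm_le` (Weil I, Thm. 8.2) and
(AL) «`|a_ℓ(g)| ≤ 1` for every weight-`2` newform `g` on `Γ₀(N)` and every prime `ℓ ∣ N`» (Atkin–Lehner 1970,
Thm. 3: `a_ℓ ∈ {0, ±1}`; hypothesis) — both IN PRINT; the research content is the lead's (C3) and the curve-side
(μ-W₁). [cite: Deligne1974, Thm. (8.2); AtkinLehner1970, Thm. 3; GreenbergVatsal2000, §1 (10) (shape; the inputs are hypotheses)] -/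
theorem thetaLayerLambdaCongruenceAtTwo_of_plusLine_curveMax_deligne
    (hC3 : ∀ (W : WeierstrassCurve ℚ) [W.IsElliptic] [W.IsGloballyMinimal], Literature.NumberTheory.EllipticCurves.Rank1Residual.GoodSS W 2 → W.Δ < 0 → ∀ (N' : ℕ), Odd N' → (∀ ℓ : ℕ, ℓ.Prime → ℓ ∣ W.conductorNorm ℤ → ℓ ∣ N') → ∀ (Φ₁ Φ₂ : ℚ → PadicAlgCl 2), (∀ (r : ℚ) (z : ℤ), Φ₁ (r + z) = Φ₁ r) → (∀ r : ℚ, Φ₁ (-r) = Φ₁ r) → (∀ (γ : CongruenceSubgroup.Gamma0 (N')) (r : ℚ), ((γ : SL(2, ℤ)) 1 0 : ℚ) * r + ((γ : SL(2, ℤ)) 1 1 : ℚ) ≠ 0 → Φ₁ ((((γ : SL(2, ℤ)) 0 0 : ℚ) * r + ((γ : SL(2, ℤ)) 0 1 : ℚ)) / (((γ : SL(2, ℤ)) 1 0 : ℚ) * r + ((γ : SL(2, ℤ)) 1 1 : ℚ))) = (if ((γ : SL(2, ℤ)) 1 0) = 0 then 0 else Φ₁ ((((γ : SL(2, ℤ))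 0 0 : ℚ)) / (((γ : SL(2, ℤ)) 1 0 : ℚ)))) + Φ₁ r) → (∀ (r : ℚ) (z : ℤ), Φ₂ (r + z) = Φ₂ r) → (∀ r : ℚ, Φ₂ (-r) = Φ₂ r) → (∀ (γ : CongruenceSubgroup.Gamma0 (N')) (r : ℚ), ((γ : SL(2, ℤ)) 1 0 : ℚ) * r + ((γ : SL(2, ℤ)) 1 1 : ℚ) ≠ 0 → Φ₂ ((((γ : SL(2, ℤ)) 0 0 : ℚ) * r + ((γ : SL(2, ℤ)) 0 1 : ℚ)) / (((γ : SL(2, ℤ)) 1 0 : ℚ) * r + ((γ : SL(2, ℤ)) 1 1 : ℚ))) = (if ((γ : SL(2, ℤ)) 1 0) = 0 then 0 else Φ₂ ((((γ : SL(2, ℤ)) 0 0 : ℚ)) / (((γ : SL(2, ℤ)) 1 0 : ℚ)))) + Φ₂ r) → (∀ r : ℚ, ‖Φ₁ r‖ ≤ 1) → (∀ r : ℚ, ‖Φ₂ r‖ ≤ 1) → (∃ r : ℚ, ‖Φ₁ r‖ = 1) → (∃ r : ℚ, ‖Φ₂ r‖ = 1) → (∀ q : ℕ, q.Prime → ¬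 q ∣ N' → ∀ r : ℚ, ‖(∑ j : Fin q, Φ₁ ((r + j) / q)) + Φ₁ (q * r) - (W.LFunction q : PadicAlgCl 2) * Φ₁ r‖ < 1) → (∀ q : ℕ, q.Prime → ¬ q ∣ N' → ∀ r : ℚ, ‖(∑ j : Fin q, Φ₂ ((r + j) / q)) + Φ₂ (q * r) - (W.LFunction q : PadicAlgCl 2) * Φ₂ r‖ < 1) → (∀ ℓ : ℕ, ℓ.Prime → ℓ ∣ N' → ∀ r : ℚ, ‖∑ j : Fin ℓ, Φ₁ ((r + j) / ℓ)‖ < 1) → (∀ ℓ : ℕ, ℓ.Prime → ℓ ∣ N' → ∀ r : ℚ, ‖∑ j : Fin ℓ, Φ₂ ((r + j) / ℓ)‖ < 1) → ∃ a : PadicAlgCl 2, ∀ r : ℚ, ‖a * Φ₁ r - Φ₂ r‖ < 1)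
    (hμW : ∀ (W : WeierstrassCurve ℚ) [W.IsElliptic] [W.IsGloballyMinimal], ¬ W.HasCM → W.analyticRank = 0 → Literature.NumberTheory.EllipticCurves.Rank1Residual.GoodSS W 2 → W.frobeniusTrace 2 = 0 → W.Δ < 0 → ∀ [NeZero (W.conductorNorm ℤ)] (f : CuspForm (CongruenceSubgroup.Gamma0 (W.conductorNorm ℤ)) 2), Literature.NumberTheory.EllipticCurves.ModularForms.IsNewformOf W f → ∀ (S₀ : Finset (IsDedekindDomain.HeightOneSpectrum (NumberField.RingOfIntegers ℚ))), (∀ v ∈ S₀, ((2 : ℕ) : NumberField.RingOfIntegers ℚ) ∉ v.asIdeal) → (∀ v : IsDedekindDomain.HeightOneSpectrum (NumberField.RingOfIntegers ℚ), ¬ W.HasGoodReductionAt v → v ∈ S₀) → ∃ n₁ : ℕ, Even n₁ ∧ ∃ s : ZMod (2 ^ n₁), ∀ r : ℚ, ‖(∑ k ∈ Fintype.piFinset (fun _ : S₀ ↦ Finset.range 3), (∏ v : S₀, ((W.localPolynomialAt (v : IsDedekindDomain.HeightOneSpectrum (NumberField.RingOfIntegers ℚ))).map (Int.castRingHom (PadicAlgCl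 2))).coeff (k v) * ((Rat.HeightOneSpectrum.natGenerator (v : IsDedekindDomain.HeightOneSpectrum (NumberField.RingOfIntegers ℚ)) : PadicAlgCl 2)⁻¹) ^ (k v)) * algebraMap ℚ (PadicAlgCl 2) (ratPlusSymbol f (r * ((∏ v : S₀, Rat.HeightOneSpectrum.natGenerator (v : IsDedekindDomain.HeightOneSpectrum (NumberField.RingOfIntegers ℚ)) ^ (k v) : ℕ) : ℚ))))‖ ≤ ‖(∑ k ∈ Fintype.piFinset (fun _ : S₀ ↦ Finset.range 3), (∏ v : S₀, ((W.localPolynomialAt (v : IsDedekindDomain.HeightOneSpectrum (NumberField.RingOfIntegers ℚ))).map (Int.castRingHom (PadicAlgCl 2))).coeff (k v) * ((Rat.HeightOneSpectrum.natGenerator (v : IsDedekindDomain.HeightOneSpectrum (NumberField.RingOfIntegers ℚ)) : PadicAlgCl 2)⁻¹) ^ (k v)) * algebraMap ℚ (PadicAlgCl 2) (ratPlusSymbol f ((((((Literature.NumberTheory.EllipticCurves.cyclotomicGenerator 2 : ZMod (2 ^ (n₁ + 2))) ^ s.val).val : ℚ) / (2 : ℚ) ^ (n₁ + 2))) * ((∏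 v : S₀, Rat.HeightOneSpectrum.natGenerator (v : IsDedekindDomain.HeightOneSpectrum (NumberField.RingOfIntegers ℚ)) ^ (k v) : ℕ) : ℚ))))‖)
    (hD : Deligne1974_heckeT_eigenvalue_norm_le)
    (hAL : ∀ (N : ℕ) [NeZero N] (f : CuspForm (CongruenceSubgroup.Gamma0 N) 2), IsNewform0 f →
      ∀ ℓ : ℕ, ℓ.Prime → ℓ ∣ N → ‖cuspCoeff f ℓ‖ ≤ 1) :
    Summit.BirchSwinnertonDyer.BirchSwinnertonDyer.Theses.ResidualThetaTransportAtTwo.ThetaLayerLambdaCongruenceAtTwo :=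
  thetaLayerLambdaCongruenceAtTwo_of_plusLine_curveMax_nonRoot hC3 hμW fun M _ g ι hg ℓ hℓ ζ hζ ↦ by
    by_cases hℓM : ℓ ∣ M
    · exact eval_partnerEulerPolynomial_ne_zero_of_levelCoeffBound ι hℓ hℓM (hAL M g hg ℓ hℓ hℓM) ζ hζ
    · exact eval_partnerEulerPolynomial_ne_zero_of_deligne ι hD hg hℓ hℓM ζ hζ

end Glue

end Summit.BirchSwinnertonDyer.BirchSwinnertonDyer.Theorems.ThetaLayerLambdaCongruenceAtTwo

end
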